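import Mathlib
import HarnessLib
import Summits.CriticalPhenomena.CardyFormulaZ2.Theorems.CardyMagicRigidityMagicFormulaTPowerSumMoments

/-!
# Line `Sketch` (v10) for crux `MagicFormulaT`, sub-goal TP `tp_twoPoint_of_limits`: the two-point
# power-sum limit glued from its two halves

Crux `Summit.CriticalPhenomena.CardyFormulaZ2.Theses.CardyMagicRigidity.MagicFormulaT`
(stmt-CriticalPhenomena-4836), line `Sketch`, skeleton v10, registered sub-goal `tp_twoPoint_of_limits`
(wave 4).  With `θ_u = u.nestingPhase f` over the honeycomb interface loops of `siteLoopConfig δ ω`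
under `triSitePercolation half`, `A₁ = Σ_u θ_u`, `A₂ = Σ_u θ_u²` and
`L = ∬ log‖x − y‖ f(x) f(y)`, the order-2 coefficient identification of line `Sketch` reads
`E[3A₁² − 4A₂] → (3/2π²) L`.  Skeleton v10 splits it into the two halves `E[A₂] → −ν L`
(`ν = 1/(2√3π)`) and `E[A₁²] → −ν₂ L` (`ν₂ = 2/(3√3π) − 1/(2π²)`); this file is the GLUE:
given the two half limits for an admissible density `f` (`|f| ≤ C`, `f = 0` off `B̄(0, R)`, `∫ f = 0`),
the combined limit follows.

Proof.  (1) At every fixed mesh `δ > 0` the power sums `A₁`, `A₂` are bounded measurable functions of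
the sample (`Staircase.exists_abs_finsum_sdiff_le`: only the finitely many loops meeting `B̄(0, R)`
carry a phase, each `|θ_u| ≤ C · Leb B̄(0, R)`, `abs_nestingPhase_le_mul_volume_closedBall`;
`FirstMoment.measurable_finsum_loops`), hence integrable under the probability law, so
`E[3A₁² − 4A₂] = 3 E[A₁²] − 4 E[A₂]` (`tp_integral_twoPoint_eq`).  (2) `Tendsto.const_mul`,
`Tendsto.sub` and `Tendsto.congr'` along `𝓝[>] 0`.  (3) The arithmetic identity
`3 · (−ν₂) + 4 · ν = 3/(2π²)` (the `√3` terms cancel: `4/(2√3π) = 2/(√3π) = 3 · 2/(3√3π)`).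
No named fact is used; no definition is introduced.
-/

noncomputable section

namespace Summit.CriticalPhenomena.CardyFormulaZ2.Cruxes.MagicFormulaT.LineSketch

open MeasureTheory Filter Set Metric
open scoped Real Topology BigOperators ENNReal
open Literature.Probability.RandomPlanarGeometry Literature.Probability.Percolation
  Literature.Probability.LatticeModels
open Summit.CriticalPhenomena.CardyFormulaZ2.Cruxes.NestingRigidity.RingCloudTomography

/-! ## Fixed mesh: integrability and linearity -/

section FixedMesh

variable {f : ℂ → ℝ} {R C : ℝ}

/-- At a fixed mesh `δ > 0`, for a density `f` with `|f| ≤ C` vanishing off `B̄(0, R)` with mean zero,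
the power sum `A₁ = Σ_u θ_u` is measurable and uniformly bounded in the sample, and so is
`A₂ = Σ_u θ_u²`: `|A₁| ≤ B₁`, `|A₂| ≤ B₂` for deterministic `B₁, B₂ ≥ 0`. -/
theorem tp_powerSums_measurable_bounded (hC : ∀ z, |f z| ≤ C) (hR : ∀ z, R < ‖z‖ → f z = 0)
    (h0 : ∫ z, f z = 0) {δ : ℝ} (hδ : 0 < δ) :
    (Measurable fun ω ↦ ∑ᶠ u ∈ (siteLoopConfig δ ω).loops, u.nestingPhase f) ∧
    (Measurable fun ω ↦ ∑ᶠ u ∈ (siteLoopConfig δ ω).loops, u.nestingPhase f ^ 2) ∧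
    (∃ B₁ : ℝ, 0 ≤ B₁ ∧ ∀ ω, |∑ᶠ u ∈ (siteLoopConfig δ ω).loops, u.nestingPhase f| ≤ B₁) ∧
    (∃ B₂ : ℝ, 0 ≤ B₂ ∧ ∀ ω, |∑ᶠ u ∈ (siteLoopConfig δ ω).loops, u.nestingPhase f ^ 2| ≤ B₂) := by
  have hC0 : 0 ≤ C := nonneg_of_abs_le hC
  set K : ℝ := C * volume.real (closedBall (0 : ℂ) R)
  have hK0 : 0 ≤ K := mul_nonneg hC0 measureReal_nonneg
  have hθK : ∀ u : UnbasedLoop ℂ, |u.nestingPhase f| ≤ K :=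
    fun u ↦ abs_nestingPhase_le_mul_volume_closedBall hC hR u
  have hθK2 : ∀ u : UnbasedLoop ℂ, |u.nestingPhase f ^ 2| ≤ K ^ 2 := fun u ↦ by
    rw [abs_pow]; exact pow_le_pow_left₀ (abs_nonneg _) (hθK u) 2
  obtain ⟨B₁, hB₁0, hB₁⟩ := Staircase.exists_abs_finsum_sdiff_le tEns tEns_mem hδ hR h0
    (fun u ↦ u.nestingPhase f) hK0 hθK (fun _ h ↦ h)
  obtain ⟨B₂, hB₂0, hB₂⟩ := Staircase.exists_abs_finsum_sdiff_le tEns tEns_mem hδ hR h0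
    (fun u ↦ u.nestingPhase f ^ 2) (sq_nonneg K) hθK2 (fun _ h ↦ by rw [h, sq, mul_zero])
  refine ⟨FirstMoment.measurable_finsum_loops tEns tEns_mem δ (fun u ↦ u.nestingPhase f),
    FirstMoment.measurable_finsum_loops tEns tEns_mem δ (fun u ↦ u.nestingPhase f ^ 2),
    ⟨B₁, hB₁0, fun ω ↦ ?_⟩, ⟨B₂, hB₂0, fun ω ↦ ?_⟩⟩
  · have h := hB₁ ω ∅
    rw [Set.sdiff_empty] at h
    exact h
  · have h := hB₂ ω ∅
    rw [Set.sdiff_empty] at h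
    exact h

/-- At a fixed mesh `δ > 0`: `A₁²` and `A₂` are integrable under `triSitePercolation half`
(bounded measurable functions, probability law). -/
theorem tp_integrable_powerSums (hC : ∀ z, |f z| ≤ C) (hR : ∀ z, R < ‖z‖ → f z = 0)
    (h0 : ∫ z, f z = 0) {δ : ℝ} (hδ : 0 < δ) :
    Integrable (fun ω ↦ (∑ᶠ u ∈ (siteLoopConfig δ ω).loops, u.nestingPhase f) ^ 2)
      (triSitePercolation half) ∧
    Integrable (fun ω ↦ ∑ᶠ u ∈ (siteLoopConfig δ ω).loops, u.nestingPhase f ^ 2)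
      (triSitePercolation half) := by
  obtain ⟨hm₁, hm₂, ⟨B₁, -, hB₁⟩, ⟨B₂, -, hB₂⟩⟩ := tp_powerSums_measurable_bounded hC hR h0 hδ
  refine ⟨Staircase.integrable_of_abs_le tEns_mem (hm₁.pow_const 2) (B := B₁ ^ 2) fun ω ↦ ?_,
    Staircase.integrable_of_abs_le tEns_mem hm₂ hB₂⟩
  rw [abs_pow]
  exact pow_le_pow_left₀ (abs_nonneg _) (hB₁ ω) 2

/-- **Linearity at a fixed mesh `δ > 0`**: `E[3A₁² − 4A₂] = 3 E[A₁²] − 4 E[A₂]`. -/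
theorem tp_integral_twoPoint_eq (hC : ∀ z, |f z| ≤ C) (hR : ∀ z, R < ‖z‖ → f z = 0)
    (h0 : ∫ z, f z = 0) {δ : ℝ} (hδ : 0 < δ) :
    ∫ ω, (3 * (∑ᶠ u ∈ (siteLoopConfig δ ω).loops, u.nestingPhase f) ^ 2 -
      4 * (∑ᶠ u ∈ (siteLoopConfig δ ω).loops, u.nestingPhase f ^ 2)) ∂(triSitePercolation half) =
    3 * ∫ ω, (∑ᶠ u ∈ (siteLoopConfig δ ω).loops, u.nestingPhase f) ^ 2 ∂(triSitePercolation half) -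
    4 * ∫ ω, (∑ᶠ u ∈ (siteLoopConfig δ ω).loops, u.nestingPhase f ^ 2) ∂(triSitePercolation half) := by
  obtain ⟨hI₁, hI₂⟩ := tp_integrable_powerSums hC hR h0 hδ
  rw [integral_sub (hI₁.const_mul 3) (hI₂.const_mul 4), integral_const_mul, integral_const_mul]

end FixedMesh

/-! ## The arithmetic identity -/

/-- `3 · (−(2/(3√3π) − 1/(2π²))) − 4 · (−1/(2√3π)) = 3/(2π²)`: the `√3` terms cancel. -/
theorem tp_const_identity (L : ℝ) :
    3 * (-(2 / (3 * Real.sqrt 3 * π) - 1 / (2 * π ^ 2)) * L) -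
      4 * (-(1 / (2 * Real.sqrt 3 * π)) * L) = 3 / (2 * π ^ 2) * L := by
  have h3 : Real.sqrt 3 ≠ 0 := Real.sqrt_ne_zero'.2 (by norm_num)
  have hπ : (π : ℝ) ≠ 0 := Real.pi_ne_zero
  field_simp
  ring

/-! ## The registered sub-goal -/

/-- **Sub-goal TP (`tp_twoPoint_of_limits`) · the two-point power-sum limit from its two halves**:
if `E[A₂] → −ν L` (`ν = 1/(2√3π)`) and `E[A₁²] → −ν₂ L` (`ν₂ = 2/(3√3π) − 1/(2π²)`) as `δ → 0⁺`,
`L = ∬ log‖x − y‖ f(x) f(y)`, then `E[3A₁² − 4A₂] → (3/2π²) L`: linearity of the expectation at every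
fixed mesh (bounded measurable power sums, `tp_integral_twoPoint_eq`), `Tendsto.sub`/`Tendsto.const_mul`,
and the identity `4ν − 3ν₂ = 3/(2π²)` (`tp_const_identity`). -/
theorem tp_twoPoint_of_limits : ∀ (f : ℂ → ℝ) (R C : ℝ), Measurable f → (∀ z, |f z| ≤ C) →
    (∀ z, R < ‖z‖ → f z = 0) → ∫ z, f z = 0 →
    Tendsto (fun δ : ℝ ↦ ∫ ω, (∑ᶠ u ∈ (siteLoopConfig δ ω).loops, u.nestingPhase f ^ 2) ∂(triSitePercolation half))
      (𝓝[>] (0 : ℝ)) (𝓝 (-(1 / (2 * Real.sqrt 3 * π)) * ∫ x, ∫ y, Real.log ‖x - y‖ * f x * f y)) →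
    Tendsto (fun δ : ℝ ↦ ∫ ω, (∑ᶠ u ∈ (siteLoopConfig δ ω).loops, u.nestingPhase f) ^ 2 ∂(triSitePercolation half))
      (𝓝[>] (0 : ℝ)) (𝓝 (-(2 / (3 * Real.sqrt 3 * π) - 1 / (2 * π ^ 2)) * ∫ x, ∫ y, Real.log ‖x - y‖ * f x * f y)) →
    Tendsto (fun δ : ℝ ↦ ∫ ω, (3 * (∑ᶠ u ∈ (siteLoopConfig δ ω).loops, u.nestingPhase f) ^ 2 -
      4 * (∑ᶠ u ∈ (siteLoopConfig δ ω).loops, u.nestingPhase f ^ 2)) ∂(triSitePercolation half))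
      (𝓝[>] (0 : ℝ)) (𝓝 (3 / (2 * π ^ 2) * ∫ x, ∫ y, Real.log ‖x - y‖ * f x * f y)) := by
  intro f R C _ hC hR h0 hA₂ hA₁
  have hlim := (hA₁.const_mul 3).sub (hA₂.const_mul 4)
  rw [tp_const_identity] at hlim
  refine hlim.congr' ?_
  filter_upwards [self_mem_nhdsWithin] with δ hδ
  exact (tp_integral_twoPoint_eq hC hR h0 hδ).symm

end Summit.CriticalPhenomena.CardyFormulaZ2.Cruxes.MagicFormulaT.LineSketch

end
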